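import Mathlib
import Summits.PneNP.PneNP.Theorems.RamseyUncertifiableRegularResolutionRungDefs
import Summits.PneNP.PneNP.Theorems.RamseyUncertifiableRegularResolutionRungTrapSparseFalseBlocks

/-!
# Two-sided bi-density of the points/hyperplanes graph (helper 4b/5 for `stub_not_biDenseTrapSparse`)

`|e(A,Y) − |A||Y|/2| ≤ 4√(2^d |A||Y|) + |A|` for all vertex sets of `hadamardGraph d` (sum of the four
block estimates), hence `|A||Y|/8 ≤ e(A,Y) ≤ 7|A||Y|/8` as soon as `|A||Y| ≥ 256·2^d` and `|Y| ≥ 8`; and the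
transport of these bounds to a copy of the graph on `Fin m` (`LowerBiDense` / `UpperBiDense` of the line's
Defs file at any scale `M₀ ≥ 8` with `M₀² ≥ 256·2^d`). [folklore]
-/

noncomputable section

open Finset Matrix

namespace Summit.PneNP.PneNP.Cruxes.RegularResolutionRung.SoundPathBottleneck.HadamardWitness

set_option linter.dupNamespace false -- `Summit.PneNP.PneNP.…`: single-conjunct summit (D-0017)

variable {d : ℕ}

/-- Ordered adjacent pairs between two vertex sets. -/
def eCnt (A Y : Finset (Vtx d)) : ℕ := ((A ×ˢ Y).filter fun q => (hadamardGraph d).Adj q.1 q.2).card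

/-- The point part of a vertex set. -/
def pts (A : Finset (Vtx d)) : Finset (Vec d) := univ.filter fun x => Sum.inl x ∈ A
/-- The hyperplane part of a vertex set. -/
def hyps (A : Finset (Vtx d)) : Finset (Hyp d) := univ.filter fun p => Sum.inr p ∈ A

/-- A vertex set is the disjoint union of its two parts. -/
theorem eq_pts_union_hyps (A : Finset (Vtx d)) :
    A = (pts A).map ⟨Sum.inl, Sum.inl_injective⟩ ∪ (hyps A).map ⟨Sum.inr, Sum.inr_injective⟩ := by
  ext v
  rcases v with x | p
  · simp [pts]
  · simp [hyps]

/-- The two parts are disjoint as vertex sets. -/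
theorem disjoint_pts_hyps (A : Finset (Vtx d)) :
    Disjoint ((pts A).map ⟨Sum.inl, Sum.inl_injective⟩) ((hyps A).map ⟨Sum.inr, Sum.inr_injective⟩) := by
  rw [Finset.disjoint_left]
  intro v h1 h2
  simp only [Finset.mem_map, Function.Embedding.coeFn_mk] at h1 h2
  obtain ⟨x, -, rfl⟩ := h1
  obtain ⟨p, -, h⟩ := h2
  exact Sum.inr_ne_inl h

/-- Cardinality splits. -/
theorem card_eq_pts_add_hyps (A : Finset (Vtx d)) : A.card = (pts A).card + (hyps A).card := by
  conv_lhs => rw [eq_pts_union_hyps A]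
  rw [Finset.card_union_of_disjoint (disjoint_pts_hyps A), Finset.card_map, Finset.card_map]

/-- Sums over a vertex set split into the two parts. -/
theorem sum_split (A : Finset (Vtx d)) (F : Vtx d → ℝ) :
    ∑ u ∈ A, F u = ∑ x ∈ pts A, F (Sum.inl x) + ∑ p ∈ hyps A, F (Sum.inr p) := by
  conv_lhs => rw [eq_pts_union_hyps A]
  rw [Finset.sum_union (disjoint_pts_hyps A), Finset.sum_map, Finset.sum_map]
  rfl

/-- The pair count as a double sum of indicators. -/
theorem eCnt_eq_sum (A Y : Finset (Vtx d)) :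
    (eCnt A Y : ℝ) = ∑ u ∈ A, ∑ v ∈ Y, if (hadamardGraph d).Adj u v then (1 : ℝ) else 0 := by
  unfold eCnt
  rw [Finset.card_filter, Nat.cast_sum, Finset.sum_product]
  refine Finset.sum_congr rfl fun u _ => Finset.sum_congr rfl fun v _ => ?_
  split_ifs <;> simp

/-- Adjacency indicators in block form. -/
theorem ite_adj_inl_inl (x y : Vec d) :
    (if (hadamardGraph d).Adj (Sum.inl x) (Sum.inl y) then (1 : ℝ) else 0) =
      if (x ≠ y ∧ x ⬝ᵥ y = 1) then (1 : ℝ) else 0 := if_congr adj_inl_inl rfl rfl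
/-- Adjacency indicator, point–hyperplane. -/
theorem ite_adj_inl_inr (x : Vec d) (p : Hyp d) :
    (if (hadamardGraph d).Adj (Sum.inl x) (Sum.inr p) then (1 : ℝ) else 0) =
      if p.a ⬝ᵥ x = p.b then (1 : ℝ) else 0 := if_congr adj_inl_inr rfl rfl
/-- Adjacency indicator, hyperplane–point. -/
theorem ite_adj_inr_inl (p : Hyp d) (y : Vec d) :
    (if (hadamardGraph d).Adj (Sum.inr p) (Sum.inl y) then (1 : ℝ) else 0) =
      if p.a ⬝ᵥ y = p.b then (1 : ℝ) else 0 := if_congr adj_inr_inl rfl rfl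
/-- Adjacency indicator, hyperplane–hyperplane. -/
theorem ite_adj_inr_inr (p p' : Hyp d) :
    (if (hadamardGraph d).Adj (Sum.inr p) (Sum.inr p') then (1 : ℝ) else 0) =
      if (p ≠ p' ∧ p.a ⬝ᵥ p'.a + p.b * p'.b = 1) then (1 : ℝ) else 0 := if_congr adj_inr_inr rfl rfl

/-- **Discrepancy of the whole graph.** `|e(A,Y) − |A||Y|/2| ≤ 4√(2^d|A||Y|) + |A|`. -/
theorem abs_eCnt_sub_half_le (A Y : Finset (Vtx d)) :
    |(eCnt A Y : ℝ) - A.card * Y.card / 2| ≤ 4 * Real.sqrt ((2 : ℝ) ^ d * (A.card * Y.card)) + A.card := by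
  set aO : ℝ := ((pts A).card : ℝ) with haO
  set aP : ℝ := ((hyps A).card : ℝ) with haP
  set yO : ℝ := ((pts Y).card : ℝ) with hyO
  set yP : ℝ := ((hyps Y).card : ℝ) with hyP
  have hA : (A.card : ℝ) = aO + aP := by rw [card_eq_pts_add_hyps]; push_cast; rfl
  have hY : (Y.card : ℝ) = yO + yP := by rw [card_eq_pts_add_hyps]; push_cast; rfl
  -- the four blocks
  set S1 : ℝ := ∑ x ∈ pts A, ∑ y ∈ pts Y, if (x ≠ y ∧ x ⬝ᵥ y = 1) then (1 : ℝ) else 0 with hS1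
  set S2 : ℝ := ∑ x ∈ pts A, ∑ p ∈ hyps Y, if p.a ⬝ᵥ x = p.b then (1 : ℝ) else 0 with hS2
  set S3 : ℝ := ∑ p ∈ hyps A, ∑ y ∈ pts Y, if p.a ⬝ᵥ y = p.b then (1 : ℝ) else 0 with hS3
  set S4 : ℝ := ∑ p ∈ hyps A, ∑ p' ∈ hyps Y,
    if (p ≠ p' ∧ p.a ⬝ᵥ p'.a + p.b * p'.b = 1) then (1 : ℝ) else 0 with hS4
  have hdec : (eCnt A Y : ℝ) = S1 + S2 + (S3 + S4) := by
    rw [eCnt_eq_sum, sum_split]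
    congr 1
    · rw [← Finset.sum_add_distrib]
      refine Finset.sum_congr rfl fun x _ => ?_
      rw [sum_split]
      simp_rw [ite_adj_inl_inl, ite_adj_inl_inr]
    · rw [← Finset.sum_add_distrib]
      refine Finset.sum_congr rfl fun p _ => ?_
      rw [sum_split]
      simp_rw [ite_adj_inr_inl, ite_adj_inr_inr]
  have h1 := block_pts_pts (pts A) (pts Y)
  have h2 := block_pts_hyps (pts A) (hyps Y)
  have h3 := block_hyps_pts (hyps A) (pts Y)
  have h4 := block_hyps_hyps (hyps A) (hyps Y)
  rw [← hS1, ← haO, ← hyO] at h1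
  rw [← hS2, ← haO, ← hyP] at h2
  rw [← hS3, ← haP, ← hyO] at h3
  rw [← hS4, ← haP, ← hyP] at h4
  -- every square root is at most R := √(2 · 2^d |A||Y|)
  set N : ℝ := A.card * Y.card with hN
  have h2d : (0 : ℝ) ≤ (2 : ℝ) ^ d := by positivity
  have haO0 : 0 ≤ aO := Nat.cast_nonneg _
  have haP0 : 0 ≤ aP := Nat.cast_nonneg _
  have hyO0 : 0 ≤ yO := Nat.cast_nonneg _
  have hyP0 : 0 ≤ yP := Nat.cast_nonneg _
  have haOle : aO ≤ A.card := by rw [hA]; linarith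
  have haPle : aP ≤ A.card := by rw [hA]; linarith
  have hyOle : yO ≤ Y.card := by rw [hY]; linarith
  have hyPle : yP ≤ Y.card := by rw [hY]; linarith
  have hR : ∀ s t c : ℝ, 0 ≤ s → s ≤ A.card → 0 ≤ t → t ≤ Y.card → 0 ≤ c → c ≤ 2 →
      Real.sqrt (s * ((2 : ℝ) ^ d * (c * t))) ≤ Real.sqrt (2 * ((2 : ℝ) ^ d * N)) := by
    intro s t c hs0 hs ht0 ht hc0 hc
    apply Real.sqrt_le_sqrt
    rw [hN]
    have : s * ((2 : ℝ) ^ d * (c * t)) = c * ((2 : ℝ) ^ d * (s * t)) := by ring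
    rw [this]
    have hst : s * t ≤ A.card * Y.card := mul_le_mul hs ht ht0 (Nat.cast_nonneg _)
    have : (2 : ℝ) ^ d * (s * t) ≤ (2 : ℝ) ^ d * (A.card * Y.card) := mul_le_mul_of_nonneg_left hst h2d
    calc c * ((2 : ℝ) ^ d * (s * t)) ≤ 2 * ((2 : ℝ) ^ d * (s * t)) := by
          apply mul_le_mul_of_nonneg_right hc; positivity
      _ ≤ 2 * ((2 : ℝ) ^ d * (↑A.card * ↑Y.card)) := by linarith
  set R : ℝ := Real.sqrt (2 * ((2 : ℝ) ^ d * N)) with hRdef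
  have hR1 : Real.sqrt (aO * ((2 : ℝ) ^ d * yO)) ≤ R := by
    have := hR aO yO 1 haO0 haOle hyO0 hyOle (by norm_num) (by norm_num)
    simpa using this
  have hR2 : Real.sqrt (aO * ((2 : ℝ) ^ d * (2 * yP))) ≤ R := hR aO yP 2 haO0 haOle hyP0 hyPle (by norm_num) le_rfl
  have hR3 : Real.sqrt (yO * ((2 : ℝ) ^ d * (2 * aP))) ≤ R := by
    have := hR aP yO 2 haP0 haPle hyO0 hyOle (by norm_num) le_rfl
    have e : yO * ((2 : ℝ) ^ d * (2 * aP)) = aP * ((2 : ℝ) ^ d * (2 * yO)) := by ring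
    rw [e]; exact this
  have hR4 : Real.sqrt (yP * ((2 : ℝ) ^ d * (2 * aP))) ≤ R := by
    have := hR aP yP 2 haP0 haPle hyP0 hyPle (by norm_num) le_rfl
    have e : yP * ((2 : ℝ) ^ d * (2 * aP)) = aP * ((2 : ℝ) ^ d * (2 * yP)) := by ring
    rw [e]; exact this
  -- R ≤ √2 · √(2^d N) ≤ 1.5 √(2^d N)
  have hRle : R ≤ 3 / 2 * Real.sqrt ((2 : ℝ) ^ d * N) := by
    rw [hRdef, Real.sqrt_mul (by norm_num : (0 : ℝ) ≤ 2)]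
    have hs2 : Real.sqrt 2 ≤ 3 / 2 := by
      rw [Real.sqrt_le_left (by norm_num)]; norm_num
    exact mul_le_mul_of_nonneg_right hs2 (Real.sqrt_nonneg _)
  -- combine
  have key : |(eCnt A Y : ℝ) - A.card * Y.card / 2| ≤ R / 2 + aO + R / 2 + R / 2 + (R + aP) := by
    rw [hdec, hA, hY]
    have e : S1 + S2 + (S3 + S4) - (aO + aP) * (yO + yP) / 2 =
        (S1 - aO * yO / 2) + (S2 - aO * yP / 2) + ((S3 - aP * yO / 2) + (S4 - aP * yP / 2)) := by ring
    rw [e]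
    calc _ ≤ |S1 - aO * yO / 2 + (S2 - aO * yP / 2)| + |S3 - aP * yO / 2 + (S4 - aP * yP / 2)| := abs_add_le _ _
      _ ≤ (|S1 - aO * yO / 2| + |S2 - aO * yP / 2|) + (|S3 - aP * yO / 2| + |S4 - aP * yP / 2|) :=
          add_le_add (abs_add_le _ _) (abs_add_le _ _)
      _ ≤ (Real.sqrt (aO * ((2 : ℝ) ^ d * yO)) / 2 + aO + Real.sqrt (aO * ((2 : ℝ) ^ d * (2 * yP))) / 2) +
          (Real.sqrt (yO * ((2 : ℝ) ^ d * (2 * aP))) / 2 + (Real.sqrt (yP * ((2 : ℝ) ^ d * (2 * aP))) + aP)) :=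
          add_le_add (add_le_add h1 h2) (add_le_add h3 h4)
      _ ≤ R / 2 + aO + R / 2 + R / 2 + (R + aP) := by linarith
  calc |(eCnt A Y : ℝ) - A.card * Y.card / 2| ≤ R / 2 + aO + R / 2 + R / 2 + (R + aP) := key
    _ = 5 / 2 * R + (aO + aP) := by ring
    _ ≤ 5 / 2 * (3 / 2 * Real.sqrt ((2 : ℝ) ^ d * N)) + A.card := by rw [← hA]; gcongr
    _ ≤ 4 * Real.sqrt ((2 : ℝ) ^ d * (A.card * Y.card)) + A.card := by
        rw [hN]; nlinarith [Real.sqrt_nonneg ((2 : ℝ) ^ d * (↑A.card * ↑Y.card))]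

/-- **Bi-density.** If `|A||Y| ≥ 256·2^d` and `|Y| ≥ 8` then `|A||Y|/8 ≤ e(A,Y) ≤ 7|A||Y|/8`. -/
theorem eCnt_bounds (A Y : Finset (Vtx d)) (hAY : (256 : ℝ) * 2 ^ d ≤ A.card * Y.card) (hY : (8 : ℝ) ≤ Y.card) :
    (1 / 8 : ℝ) * A.card * Y.card ≤ eCnt A Y ∧ (eCnt A Y : ℝ) ≤ (1 - 1 / 8) * A.card * Y.card := by
  have h := abs_eCnt_sub_half_le A Y
  set N : ℝ := A.card * Y.card with hN
  have hN0 : 0 ≤ N := by positivity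
  have hsq : Real.sqrt ((2 : ℝ) ^ d * N) ≤ N / 16 := by
    rw [Real.sqrt_le_left (by positivity)]
    nlinarith
  have hA8 : (A.card : ℝ) ≤ N / 8 := by
    rw [hN]
    have hA0 : (0 : ℝ) ≤ A.card := Nat.cast_nonneg _
    nlinarith
  rw [abs_le] at h
  constructor
  · nlinarith [h.1]
  · nlinarith [h.2]

/-! ## Transport to `Fin m` -/

/-- The copy of `hadamardGraph d` on `Fin m` along an equivalence. -/
def finGraph {m : ℕ} (e : Fin m ≃ Vtx d) : SimpleGraph (Fin m) := (hadamardGraph d).comap e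

/-- Classical decidability of adjacency in the copy. -/
instance {m : ℕ} (e : Fin m ≃ Vtx d) : DecidableRel (finGraph e).Adj := fun _ _ => Classical.propDecidable _

/-- Pair counts transport. -/
theorem edgeCount_finGraph {m : ℕ} (e : Fin m ≃ Vtx d) (A B : Finset (Fin m)) :
    edgeCount (finGraph e) A B = eCnt (A.map e.toEmbedding) (B.map e.toEmbedding) := by
  classical
  unfold edgeCount eCnt
  rw [← Finset.prodMap_map_product, Finset.filter_map, Finset.card_map]
  rfl

/-- **The transported graph is two-sided bi-dense with density `1/8`** at every scale `M₀ ≥ 8` with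
`M₀² ≥ 256·2^d`. -/
theorem biDense_finGraph {m : ℕ} (e : Fin m ≃ Vtx d) (M₀ : ℕ) (h8 : 8 ≤ M₀)
    (hM : (256 : ℝ) * 2 ^ d ≤ (M₀ : ℝ) * M₀) :
    LowerBiDense (finGraph e) M₀ (1 / 8) ∧ UpperBiDense (finGraph e) M₀ (1 / 8) := by
  have key : ∀ A B : Finset (Fin m), M₀ ≤ A.card → M₀ ≤ B.card →
      (1 / 8 : ℝ) * A.card * B.card ≤ edgeCount (finGraph e) A B ∧
        (edgeCount (finGraph e) A B : ℝ) ≤ (1 - 1 / 8) * A.card * B.card := by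
    intro A B hA hB
    rw [edgeCount_finGraph]
    have hcA : (A.map e.toEmbedding).card = A.card := Finset.card_map _
    have hcB : (B.map e.toEmbedding).card = B.card := Finset.card_map _
    have hAR : (M₀ : ℝ) ≤ A.card := by exact_mod_cast hA
    have hBR : (M₀ : ℝ) ≤ B.card := by exact_mod_cast hB
    have h8R : (8 : ℝ) ≤ M₀ := by exact_mod_cast h8
    have hM0 : (0 : ℝ) ≤ M₀ := by linarith
    have := eCnt_bounds (A.map e.toEmbedding) (B.map e.toEmbedding)
      (by rw [hcA, hcB]; exact hM.trans (mul_le_mul hAR hBR hM0 (Nat.cast_nonneg _)))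
      (by rw [hcB]; exact h8R.trans hBR)
    rw [hcA, hcB] at this
    exact this
  exact ⟨fun A B hA hB => (key A B hA hB).1, fun A B hA hB => (key A B hA hB).2⟩

/-- Anchor (registered sub-goal `hw_biDense_anchor` of stmt-PneNP-9818): two-sided `1/8`-bi-density of the copy. -/
theorem hw_biDense_anchor : ∀ (d m : ℕ) (e : Fin m ≃ Vtx d) (M₀ : ℕ), 8 ≤ M₀ →
    (256 : ℝ) * 2 ^ d ≤ (M₀ : ℝ) * M₀ →
    LowerBiDense (finGraph e) M₀ (1 / 8) ∧ UpperBiDense (finGraph e) M₀ (1 / 8) :=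
  fun _ _ e M₀ h8 hM => biDense_finGraph e M₀ h8 hM

end Summit.PneNP.PneNP.Cruxes.RegularResolutionRung.SoundPathBottleneck.HadamardWitness

end
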